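import Summits.Parity.BatemanHorn.Theorems.SoloInformedTwinUnbalancedSwitch
import Summits.Parity.BatemanHorn.Theorems.SoloInformedMoebiusSWHypAux

/-!
# SoloInformedTwinUnbalancedPieces — the switched unbalanced sums carry Möbius log-power pieces

Solo unit `solo-Parity-informed` (ideation tier, informed mode), session 79; `paper.md` §20
(Theorem 20.1 = (F′), step (1)), PLAN §60 (file F1 of the kernel project F1–F5, second half;
first half = `SoloInformedTwinUnbalancedSwitch`), CLAIMS C144/C148.

`SoloInformedTwinUnbalancedSwitch` writes the unbalanced part `U` of the located twin sum as
`∑_{q ≤ z}` of four generic switched sums `switchedSum lo hi q r₀ a (twinSwitchWeight y q)`,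
`w_q(e) = 𝟙[y < qe] μ(q)μ(e) log²(qe)`.  Here (still no estimate):

1. linearity of `switchedSum` in the weight and the triangle inequality;
2. the weight expanded by `log²(qe) = log²q + 2 log q log e + log²e`
   (`switchedSum_twinSwitchWeight`: `S(w_q) = μ(q)(log²q·S(P₀) + 2 log q·S(P₁) + S(P₂))`,
   `P_j(e) = 𝟙[y < qe] μ(e) logʲe`), with `|S(w_q)| ≤ log²q |S(P₀)| + 2 log q |S(P₁)| + |S(P₂)|`;
3. after the expansion the `e`-variable carries exactly a MÖBIUS LOG-POWER PIECE
   `moebiusLogPiece j r₀ a b` of `SoloInformedMoebiusSWHypAux` (F2; its Siegel–Walfisz hypothesis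
   (A₂) is `siegelWalfiszHyp_moebiusLogPiece`) — in two packagings: per cofactor `k` an interval
   class sum `e ∈ (max(y/q,(lo−1)/k), hi/k]`, `ke ≡ a (q)` (the shape for Bombieri–Vinogradov for
   `μ`, file F3: `switchedSum_moebiusLogCut_eq_piece`), and with the hyperbolic cut `lo ≤ ke ≤ hi`
   kept as an indicator against the FIXED piece on `(y/q, hi]` (the shape for [BFI86, Thm 0(b)],
   file F4: `switchedSum_moebiusLogCut_eq_piece'`);
4. bookkeeping used downstream: `ke ≡ a (q)` with `(q, a) = 1` forces `(k, q) = (e, q) = 1`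
   (so only coprime cofactors and divisors occur: `±1` is prime to every `q`, `±2` to odd `q`),
   and the odd family (`r₀ = 2`, `a = ±2`) vanishes identically at even moduli.

Deliberately NOT here: any estimate ((F′) itself is files F3–F5).
-/

namespace Summit.Parity.BatemanHorn.Theorems

open Finset ArithmeticFunction
open scoped ArithmeticFunction.Moebius

/-! ### 1. Linearity of the switched sum; the `log²` expansion -/

/-- `switchedSum` only sees the weight at positive arguments. -/
theorem switchedSum_congr {lo hi q r₀ : ℕ} {a : ℤ} {w₁ w₂ : ℕ → ℝ} (h : ∀ e, 0 < e → w₁ e = w₂ e) :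
    switchedSum lo hi q r₀ a w₁ = switchedSum lo hi q r₀ a w₂ := by
  refine sum_congr rfl fun k _ => sum_congr rfl fun e he => ?_
  rw [h e (mem_Icc.mp he).1]

/-- `switchedSum` is additive in the weight. -/
theorem switchedSum_add (lo hi q r₀ : ℕ) (a : ℤ) (w₁ w₂ : ℕ → ℝ) :
    switchedSum lo hi q r₀ a (fun e => w₁ e + w₂ e)
      = switchedSum lo hi q r₀ a w₁ + switchedSum lo hi q r₀ a w₂ := by
  rw [switchedSum, switchedSum, switchedSum, ← sum_add_distrib]
  refine sum_congr rfl fun k _ => ?_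
  rw [← sum_add_distrib]
  refine sum_congr rfl fun e _ => ?_
  split_ifs <;> ring

/-- `switchedSum` is homogeneous in the weight. -/
theorem switchedSum_const_mul (lo hi q r₀ : ℕ) (a : ℤ) (c : ℝ) (w : ℕ → ℝ) :
    switchedSum lo hi q r₀ a (fun e => c * w e) = c * switchedSum lo hi q r₀ a w := by
  rw [switchedSum, switchedSum, mul_sum]
  refine sum_congr rfl fun k _ => ?_
  rw [mul_sum]
  refine sum_congr rfl fun e _ => ?_
  split_ifs <;> ring

/-- Triangle inequality for the switched sum. -/
theorem abs_switchedSum_le (lo hi q r₀ : ℕ) (a : ℤ) (w : ℕ → ℝ) :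
    |switchedSum lo hi q r₀ a w| ≤ switchedSum lo hi q r₀ a (fun e => |w e|) := by
  refine (abs_sum_le_sum_abs _ _).trans (sum_le_sum fun k _ => ?_)
  refine (abs_sum_le_sum_abs _ _).trans (sum_le_sum fun e _ => ?_)
  split_ifs
  · exact le_rfl
  · rw [abs_zero]

/-- The Möbius log-power weight with the cut `y < qe`:
`P_j(y, q; e) = 𝟙[y < qe] μ(e) (log e)^j`. -/
noncomputable def moebiusLogCut (y q j e : ℕ) : ℝ :=
  if y < q * e then (μ e : ℝ) * Real.log e ^ j else 0

/-- `w_y(q, e) = μ(q) (log²q · P₀ + 2 log q · P₁ + P₂)(e)` for `q, e ≥ 1`. -/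
theorem twinSwitchWeight_eq_expand {q e : ℕ} (hq : 0 < q) (he : 0 < e) (y : ℕ) :
    twinSwitchWeight y q e = (μ q : ℝ) * (Real.log q ^ 2 * moebiusLogCut y q 0 e
        + 2 * Real.log q * moebiusLogCut y q 1 e + moebiusLogCut y q 2 e) := by
  unfold twinSwitchWeight moebiusLogCut
  split_ifs with h
  · rw [Nat.cast_mul, Real.log_mul (Nat.cast_pos.mpr hq).ne' (Nat.cast_pos.mpr he).ne']
    ring
  · ring

/-- **The `log²` expansion of a switched sum** (`q ≥ 1`):
`S(w_q) = μ(q) · (log²q · S(P₀) + 2 log q · S(P₁) + S(P₂))`. -/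
theorem switchedSum_twinSwitchWeight {q : ℕ} (hq : 0 < q) (lo hi r₀ y : ℕ) (a : ℤ) :
    switchedSum lo hi q r₀ a (twinSwitchWeight y q)
      = (μ q : ℝ) * (Real.log q ^ 2 * switchedSum lo hi q r₀ a (moebiusLogCut y q 0)
          + 2 * Real.log q * switchedSum lo hi q r₀ a (moebiusLogCut y q 1)
          + switchedSum lo hi q r₀ a (moebiusLogCut y q 2)) := by
  rw [switchedSum_congr (fun e he => twinSwitchWeight_eq_expand hq he y), switchedSum_const_mul,
    switchedSum_add, switchedSum_add, switchedSum_const_mul, switchedSum_const_mul]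

/-- **Triangle inequality after the expansion** (`q ≥ 1`, so `log q ≥ 0`, `|μ(q)| ≤ 1`):
`|S(w_q)| ≤ log²q |S(P₀)| + 2 log q |S(P₁)| + |S(P₂)|`. -/
theorem abs_switchedSum_twinSwitchWeight_le {q : ℕ} (hq : 0 < q) (lo hi r₀ y : ℕ) (a : ℤ) :
    |switchedSum lo hi q r₀ a (twinSwitchWeight y q)|
      ≤ Real.log q ^ 2 * |switchedSum lo hi q r₀ a (moebiusLogCut y q 0)|
          + 2 * Real.log q * |switchedSum lo hi q r₀ a (moebiusLogCut y q 1)|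
          + |switchedSum lo hi q r₀ a (moebiusLogCut y q 2)| := by
  rw [switchedSum_twinSwitchWeight hq, abs_mul]
  have hμ : |(μ q : ℝ)| ≤ 1 := by exact_mod_cast ArithmeticFunction.abs_moebius_le_one
  have hL : 0 ≤ Real.log q := Real.log_natCast_nonneg q
  set S₀ := switchedSum lo hi q r₀ a (moebiusLogCut y q 0)
  set S₁ := switchedSum lo hi q r₀ a (moebiusLogCut y q 1)
  set S₂ := switchedSum lo hi q r₀ a (moebiusLogCut y q 2)
  have h3 : |Real.log q ^ 2 * S₀ + 2 * Real.log q * S₁ + S₂|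
      ≤ Real.log q ^ 2 * |S₀| + 2 * Real.log q * |S₁| + |S₂| := by
    refine (abs_add_le _ _).trans (add_le_add ((abs_add_le _ _).trans (add_le_add ?_ ?_)) le_rfl)
    · rw [abs_mul, abs_of_nonneg (by positivity : (0 : ℝ) ≤ Real.log q ^ 2)]
    · rw [abs_mul, abs_of_nonneg (by positivity : (0 : ℝ) ≤ 2 * Real.log q)]
  have h0 : 0 ≤ Real.log q ^ 2 * |S₀| + 2 * Real.log q * |S₁| + |S₂| := by positivity
  calc |(μ q : ℝ)| * |Real.log q ^ 2 * S₀ + 2 * Real.log q * S₁ + S₂|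
      ≤ 1 * (Real.log q ^ 2 * |S₀| + 2 * Real.log q * |S₁| + |S₂|) :=
        mul_le_mul hμ h3 (abs_nonneg _) zero_le_one
    _ = _ := one_mul _

/-! ### 2. The `e`-variable is a Möbius log-power piece (two packagings) -/

/-- The switched condition rewritten on the pieces' side (`k, q ≥ 1`, `lo ≥ 1`). -/
theorem switch_cond_iff {k q lo : ℕ} (hk : 0 < k) (hq : 0 < q) (hlo : 1 ≤ lo) (hi r₀ y e : ℕ)
    (cls : Prop) :
    ((lo ≤ k * e ∧ k * e ≤ hi ∧ (k * e).Coprime r₀ ∧ cls) ∧ y < q * e)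
      ↔ (k.Coprime r₀ ∧ cls ∧
          ((y / q < e ∧ (lo - 1) / k < e) ∧ e ≤ hi / k ∧ e.Coprime r₀)) := by
  rw [Nat.coprime_mul_iff_left, Nat.div_lt_iff_lt_mul hq, Nat.div_lt_iff_lt_mul hk,
    Nat.le_div_iff_mul_le hk, Nat.mul_comm e q, Nat.mul_comm e k]
  constructor
  · rintro ⟨⟨h1, h2, ⟨h3, h4⟩, h5⟩, h6⟩
    exact ⟨h3, h5, ⟨h6, by omega⟩, h2, h4⟩
  · rintro ⟨h3, h5, ⟨h6, h1⟩, h2, h4⟩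
    exact ⟨⟨by omega, h2, ⟨h3, h4⟩, h5⟩, h6⟩

/-- Packaging P (per cofactor, an INTERVAL CLASS SUM — the shape for Bombieri–Vinogradov):
for `k, q ≥ 1`, `lo ≥ 1`,
`∑_e 𝟙[cond(ke)] P_j(e) = 𝟙[(k,r₀)=1] ∑_{e : ke ≡ a (q)} moebiusLogPiece j r₀ (max(y/q,(lo−1)/k)) (hi/k) e`. -/
theorem inner_sum_eq_moebiusLogPiece {k q lo : ℕ} (hk : 0 < k) (hq : 0 < q) (hlo : 1 ≤ lo)
    (hi r₀ y j : ℕ) (a : ℤ) :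
    ∑ e ∈ Icc 1 hi, (if lo ≤ k * e ∧ k * e ≤ hi ∧ (k * e).Coprime r₀ ∧
          ((k * e : ℕ) : ZMod q) = (a : ZMod q) then moebiusLogCut y q j e else 0)
      = (if k.Coprime r₀ then (1 : ℝ) else 0) *
          ∑ e ∈ Icc 1 hi, (if ((k * e : ℕ) : ZMod q) = (a : ZMod q)
            then moebiusLogPiece j r₀ (max (y / q) ((lo - 1) / k)) (hi / k) e else 0) := by
  by_cases hkc : k.Coprime r₀
  · rw [if_pos hkc, one_mul]
    refine sum_congr rfl fun e _ => ?_
    simp only [moebiusLogCut, moebiusLogPiece, max_lt_iff]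
    simp only [← ite_and]
    refine if_congr ?_ rfl rfl
    exact (switch_cond_iff hk hq hlo hi r₀ y e _).trans (and_iff_right hkc)
  · rw [if_neg hkc, zero_mul]
    refine sum_eq_zero fun e _ => ?_
    rw [if_neg]
    rintro ⟨-, -, hcop, -⟩
    exact hkc (Nat.coprime_mul_iff_left.mp hcop).1

/-- **Packaging P for the switched sums** (`q ≥ 1`, `lo ≥ 1`): `S(P_j) =
∑_{k ≤ hi, (k,r₀)=1} ∑_{e ≤ hi, ke ≡ a (q)} moebiusLogPiece j r₀ (max(y/q,(lo−1)/k)) (hi/k) e`. -/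
theorem switchedSum_moebiusLogCut_eq_piece {q lo : ℕ} (hq : 0 < q) (hlo : 1 ≤ lo) (hi r₀ y j : ℕ)
    (a : ℤ) :
    switchedSum lo hi q r₀ a (moebiusLogCut y q j)
      = ∑ k ∈ Icc 1 hi, (if k.Coprime r₀ then (1 : ℝ) else 0) *
          ∑ e ∈ Icc 1 hi, (if ((k * e : ℕ) : ZMod q) = (a : ZMod q)
            then moebiusLogPiece j r₀ (max (y / q) ((lo - 1) / k)) (hi / k) e else 0) :=
  sum_congr rfl fun _ hk => inner_sum_eq_moebiusLogPiece (mem_Icc.mp hk).1 hq hlo hi r₀ y j a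

/-- Packaging R (the hyperbolic cut `lo ≤ ke ≤ hi` kept as an indicator against the FIXED piece on
`(y/q, hi]` — the shape for the bilinear large sieve): pointwise form (`q ≥ 1`). -/
theorem ite_moebiusLogCut_eq_piece {q : ℕ} (hq : 0 < q) (k lo hi r₀ y j : ℕ) (a : ℤ) {e : ℕ}
    (he : e ∈ Icc 1 hi) :
    (if lo ≤ k * e ∧ k * e ≤ hi ∧ (k * e).Coprime r₀ ∧ ((k * e : ℕ) : ZMod q) = (a : ZMod q)
        then moebiusLogCut y q j e else 0)
      = (if lo ≤ k * e ∧ k * e ≤ hi ∧ ((k * e : ℕ) : ZMod q) = (a : ZMod q) then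
          (if k.Coprime r₀ then (1 : ℝ) else 0) * moebiusLogPiece j r₀ (y / q) hi e else 0) := by
  have hehi := (mem_Icc.mp he).2
  simp only [moebiusLogCut, moebiusLogPiece, boole_mul, Nat.coprime_mul_iff_left,
    Nat.div_lt_iff_lt_mul hq, Nat.mul_comm e q]
  simp only [← ite_and]
  refine if_congr ?_ rfl rfl
  constructor
  · rintro ⟨⟨h1, h2, ⟨h3, h4⟩, h5⟩, h6⟩
    exact ⟨⟨h1, h2, h5⟩, h3, h6, hehi, h4⟩
  · rintro ⟨⟨h1, h2, h5⟩, h3, h6, -, h4⟩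
    exact ⟨⟨h1, h2, ⟨h3, h4⟩, h5⟩, h6⟩

/-- **Packaging R for the switched sums** (`q ≥ 1`): `S(P_j) =
∑_{k ≤ hi} ∑_{e ≤ hi} 𝟙[lo ≤ ke ≤ hi, ke ≡ a (q)] · 𝟙[(k,r₀)=1] · moebiusLogPiece j r₀ (y/q) hi e`. -/
theorem switchedSum_moebiusLogCut_eq_piece' {q : ℕ} (hq : 0 < q) (lo hi r₀ y j : ℕ) (a : ℤ) :
    switchedSum lo hi q r₀ a (moebiusLogCut y q j)
      = ∑ k ∈ Icc 1 hi, ∑ e ∈ Icc 1 hi,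
          (if lo ≤ k * e ∧ k * e ≤ hi ∧ ((k * e : ℕ) : ZMod q) = (a : ZMod q) then
            (if k.Coprime r₀ then (1 : ℝ) else 0) * moebiusLogPiece j r₀ (y / q) hi e else 0) :=
  sum_congr rfl fun k _ => sum_congr rfl fun _ he => ite_moebiusLogCut_eq_piece hq k lo hi r₀ y j a he

/-! ### 3. Coprimality forced by the class; the odd family at even moduli -/

/-- `t ≡ a (mod q)` with `(q, a) = 1` forces `(t, q) = 1`. -/
theorem coprime_of_natCast_zmod_eq {t q : ℕ} {a : ℤ} (h : ((t : ℕ) : ZMod q) = (a : ZMod q))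
    (ha : IsCoprime (q : ℤ) a) : t.Coprime q := by
  rw [natCast_zmod_eq_intCast_iff] at h
  obtain ⟨m, hm⟩ := h
  have ha' : IsCoprime (q : ℤ) ((t : ℤ) + q * m) := by
    rw [show (t : ℤ) + q * m = a by rw [← hm]; ring]
    exact ha
  exact (Nat.isCoprime_iff_coprime.mp ha'.of_add_mul_left_right).symm

/-- In a term of `S(lo, hi; q, r₀, a)` with `(q, a) = 1` both the cofactor and the switched
divisor are prime to the modulus. -/
theorem coprime_and_coprime_of_switch_cond {k e q : ℕ} {a : ℤ}
    (h : ((k * e : ℕ) : ZMod q) = (a : ZMod q)) (ha : IsCoprime (q : ℤ) a) :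
    k.Coprime q ∧ e.Coprime q :=
  Nat.coprime_mul_iff_left.mp (coprime_of_natCast_zmod_eq h ha)

/-- The residues `±2` are prime to odd moduli (`±1` are prime to all: `isCoprime_one_right`). -/
theorem isCoprime_two_of_odd {q : ℕ} (hq : Odd q) : IsCoprime (q : ℤ) 2 := by
  have h := Nat.isCoprime_iff_coprime.mpr (Nat.coprime_two_right.mpr hq)
  simpa using h

/-- The residue `−2` is prime to odd moduli. -/
theorem isCoprime_neg_two_of_odd {q : ℕ} (hq : Odd q) : IsCoprime (q : ℤ) (-2) :=
  (isCoprime_two_of_odd hq).neg_right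

/-- The odd family vanishes at even moduli: `ke` odd and `ke ≡ a (mod q)` with `2 ∣ q`, `2 ∣ a`
is impossible, so `S(lo, hi; q, 2, a)(w) = 0`. -/
theorem switchedSum_eq_zero_of_even {q : ℕ} {a : ℤ} (hq : 2 ∣ q) (ha : (2 : ℤ) ∣ a)
    (lo hi : ℕ) (w : ℕ → ℝ) : switchedSum lo hi q 2 a w = 0 := by
  refine sum_eq_zero fun k _ => sum_eq_zero fun e _ => ?_
  rw [if_neg]
  rintro ⟨-, -, hcop, hcl⟩
  rw [natCast_zmod_eq_intCast_iff] at hcl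
  have h2 : (2 : ℤ) ∣ ((k * e : ℕ) : ℤ) := by
    have : (2 : ℤ) ∣ a - (k * e : ℕ) := (Int.natCast_dvd_natCast.mpr hq).trans hcl
    have h' := dvd_sub ha this
    rwa [sub_sub_cancel] at h'
  have : 2 ∣ k * e := Int.natCast_dvd_natCast.mp h2
  have h1 : Nat.gcd (k * e) 2 = 1 := hcop
  have : (2 : ℕ) ∣ 1 := h1 ▸ Nat.dvd_gcd this (dvd_refl 2)
  omega

end Summit.Parity.BatemanHorn.Theorems
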